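import Summits.CriticalPhenomena.PercolationContinuityZ3.Theorems.PercNearOneGluingNoHeavyLowerTailSahiSlotPatternSymm
import Summits.CriticalPhenomena.PercolationContinuityZ3.Theorems.PercNearOneGluingNoHeavyLowerTailSahiAbsorbedIndependent

/-!
# The pattern functional VANISHES on axis-separated (slab / cylinder) families — the all-order zero locus, coefficientwise

Support file (lane `prim-masterthm-p3`, generation 18; `--supports stmt-CriticalPhenomena-4575`).  Pure proofs, no definitions,
no `sorry`, standard axioms.

A family `f : Fin k → [k]^d → ℝ` is AXIS-SEPARATED if `f_j(x) = φ_j(x_{a_j})` for an INJECTIVE axis assignment `j ↦ a_j` (each member is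
a one-axis cylinder, different members on different axes).  Under every product weight such a family is fully independent
(`ex_prod_axisSep`), so `E_k` vanishes at the value level (`SahiAbsorbed.sahiE_eq_zero_of_indep`), and by the extraction principle
(`sum_perm_eq_of_forall_gridW`) the pattern functional vanishes too:
  **`patternForm_axisSep_eq_zero`: `patternForm d (k+2) f = 0` for every axis-separated family** (no monotonicity needed).
With the branching rule (`…SahiSlotPatternBranching`: a constant member contributes `n · Σ_skeletons`, and restrictions of slabs to
sub-boxes are slabs) this covers the configurations "three orthogonal slabs + the whole cube" on `[4]^3` on which the adversarial
minimisers of the open cell `(3,4)` accumulate (lane HIERARCHY §26(l),(q)): there `Φ = 0` exactly.  Cell `prim-sahi` has the finer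
order-3 zero locus (`…ZeroLocus`); this is the all-order slab case. [this work]
-/

namespace Summit.CriticalPhenomena.PercolationContinuityZ3.Theorems

open Finset Function Equiv Equiv.Perm
open Literature.Combinatorics.Sahi2008 Literature.Combinatorics.Sahi2008.CycleForm

namespace SahiSlot

section Slabs

open scoped Classical

variable {d k : ℕ} {Y : Type*} [Fintype Y]

/-- One axis, at most one factor: `Σ_y g(y) Π_{j∈T} φ_j(y) = Π_{j∈T} Σ_y g(y) φ_j(y)` when `|T| ≤ 1` and `Σ g = 1`. [this work] -/
theorem sum_mul_prod_of_card_le_one {ι : Type*} (T : Finset ι) (hT : T.card ≤ 1) (g : Y → ℝ) (hg : ∑ y, g y = 1)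
    (φ : ι → Y → ℝ) : ∑ y, g y * ∏ j ∈ T, φ j y = ∏ j ∈ T, ∑ y, g y * φ j y := by
  rcases T.eq_empty_or_nonempty with rfl | ⟨j, hj⟩
  · simp [hg]
  · have hT' : T = {j} := Finset.eq_singleton_iff_unique_mem.2 ⟨hj, fun i hi => Finset.card_le_one.1 hT i hi j hj⟩
    subst hT'
    simp

/-- A one-axis function under a product weight: `E_g[ψ(x_{a₀})] = Σ_y g_{a₀}(y) ψ(y)`. [this work] -/
theorem ex_gridW_single_axis (g : Fin d → Y → ℝ) (hg : ∀ a, ∑ y, g a y = 1) (a₀ : Fin d) (ψ : Y → ℝ) :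
    ex (gridW g) (fun x => ψ (x a₀)) = ∑ y, g a₀ y * ψ y := by
  rw [ex_def]
  have hx : ∀ x : Fin d → Y, gridW g x * ψ (x a₀) = ∏ a, (g a (x a) * if a = a₀ then ψ (x a) else 1) := by
    intro x
    unfold gridW
    rw [prod_mul_distrib, Fintype.prod_ite_eq']
  simp_rw [hx]
  rw [← Fintype.prod_sum (fun a y => g a y * if a = a₀ then ψ y else 1)]
  rw [Fintype.prod_eq_single a₀ (fun a ha => by simp [ha, hg a])]
  simp

/-- Any family of one-axis functions under a product weight, regrouped by axes:
`E_g[Π_{j∈B} φ_j(x_{a_j})] = Π_a Σ_y g_a(y) Π_{j∈B, a_j = a} φ_j(y)`. [this work] -/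
theorem ex_gridW_prod_axis (g : Fin d → Y → ℝ) (ax : Fin k → Fin d) (φ : Fin k → Y → ℝ) (B : Finset (Fin k)) :
    ex (gridW g) (fun x => ∏ j ∈ B, φ j (x (ax j))) = ∏ a, ∑ y, g a y * ∏ j ∈ B.filter (fun j => ax j = a), φ j y := by
  have hfib : ∀ x : Fin d → Y, ∏ j ∈ B, φ j (x (ax j)) = ∏ a, ∏ j ∈ B.filter (fun j => ax j = a), φ j (x a) := by
    intro x
    rw [← Finset.prod_fiberwise_of_maps_to (g := ax) (t := univ) (fun j _ => mem_univ _)]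
    refine prod_congr rfl fun a _ => prod_congr rfl fun j hj => ?_
    rw [mem_filter] at hj
    rw [hj.2]
  rw [ex_def]
  simp_rw [hfib]
  have hx : ∀ x : Fin d → Y, gridW g x * ∏ a, ∏ j ∈ B.filter (fun j => ax j = a), φ j (x a) =
      ∏ a, (g a (x a) * ∏ j ∈ B.filter (fun j => ax j = a), φ j (x a)) := by
    intro x
    unfold gridW
    rw [← prod_mul_distrib]
  simp_rw [hx]
  exact (Fintype.prod_sum (fun a y => g a y * ∏ j ∈ B.filter (fun j => ax j = a), φ j y)).symm

/-- **Axis-separated families are fully independent under every product weight**: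
`E_g[Π_{j∈B} φ_j(x_{a_j})] = Π_{j∈B} E_g[φ_j(x_{a_j})]` for an INJECTIVE axis assignment `a`. [this work] -/
theorem ex_prod_axisSep (g : Fin d → Y → ℝ) (hg : ∀ a, ∑ y, g a y = 1) (ax : Fin k → Fin d) (hax : Injective ax)
    (φ : Fin k → Y → ℝ) (B : Finset (Fin k)) :
    ex (gridW g) (fun x => ∏ j ∈ B, φ j (x (ax j))) = ∏ j ∈ B, ex (gridW g) (fun x => φ j (x (ax j))) := by
  have hcard : ∀ a, (B.filter fun j => ax j = a).card ≤ 1 := by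
    intro a
    refine Finset.card_le_one.2 fun j hj j' hj' => ?_
    rw [mem_filter] at hj hj'
    exact hax (hj.2.trans hj'.2.symm)
  rw [ex_gridW_prod_axis g ax φ B]
  simp_rw [ex_gridW_single_axis g hg]
  rw [prod_congr rfl fun a _ => sum_mul_prod_of_card_le_one _ (hcard a) (g a) (hg a) φ]
  -- `Π_a Π_{j ∈ B, a_j = a} F(a, j) = Π_{j∈B} F(a_j, j)`
  rw [← Finset.prod_fiberwise_of_maps_to (s := B) (g := ax) (t := univ) (fun j _ => mem_univ _)]
  refine prod_congr rfl fun a _ => prod_congr rfl fun j hj => ?_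
  rw [mem_filter] at hj
  rw [hj.2]

/-- **THE ALL-ORDER ZERO LOCUS, COEFFICIENTWISE**: the pattern functional vanishes on every axis-separated family of `k+2` one-axis
functions on distinct axes of `[k+2]^d`. [this work] -/
theorem patternForm_axisSep_eq_zero (ax : Fin (k + 2) → Fin d) (hax : Injective ax) (φ : Fin (k + 2) → Fin (k + 2) → ℝ) :
    patternForm d (k + 2) (fun j (q : Q d (k + 2)) => φ j (q (ax j))) = 0 := by
  have key := sum_perm_eq_of_forall_gridW (d := d) (n := k + 2) (by omega)
    (fun r => diagForm d (k + 2) (fun j => (fun q : Q d (k + 2) => φ j (q (ax j))) ∘ slotMap r)) (fun _ => 0)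
    (fun g hg => by
      rw [← sahiE_gridW_eq_sum_diagForm g hg (by omega)]
      simp only [mul_zero, sum_const_zero]
      exact SahiAbsorbed.sahiE_eq_zero_of_indep (gridW g) (sum_gridW g hg) _ fun B => ex_prod_axisSep g hg ax hax φ B)
  simp only [sum_const_zero] at key
  exact key

/-- In particular for SLABS (one-axis indicator sets on distinct axes): `patternForm = 0`, with no monotonicity hypothesis. [this work] -/
theorem patternForm_slabs_eq_zero (ax : Fin (k + 2) → Fin d) (hax : Injective ax) (S : Fin (k + 2) → Finset (Fin (k + 2))) :
    patternForm d (k + 2) (fun j => setInd (univ.filter fun q : Q d (k + 2) => q (ax j) ∈ S j)) = 0 := by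
  have h := patternForm_axisSep_eq_zero ax hax (fun j y => if y ∈ S j then (1 : ℝ) else 0)
  convert h using 2
  funext j q
  simp [setInd_apply]

end Slabs

end SahiSlot

end Summit.CriticalPhenomena.PercolationContinuityZ3.Theorems
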